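import Literature.Computability.ImplicitComplexity.SoftTypeAssignmentSubstFresh
import Mathlib.Data.Nat.Pairing
import HarnessLib

/-!
# The substitution lemma of `STA₊`, IV: renamed-apart copies of a substituend (rule `(m)`, data)

Continuation of the Substitution Lemma files (GR07/GMR08). When the main derivation ends with a
multiplexor `(m)` contracting the slots `S` into the substituted slot `x : !σ`, the substituend
`N` of `x` (a level-`0` derivation `Δₓ ⊢ N : B`, to be promoted `ℓ x` times) has to be substituted
for EVERY slot `s ∈ S` of the premise, each copy one level lower and with its own copy of the
context `Δₓ` (GR07, proof of the Substitution Lemma, case `(m)`; this is where the rank bound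
`|S| ≤ r` pays for the weight `r · W` of a box). This file builds that family of copies:

* `STA.copyRen L s` — the slots of the `s`-th copy, `t ↦ L + ⟨s, t⟩` (Cantor pairing above `L`);
* `STA.cpX`, `STA.cpN`, `STA.cpΔ`, `STA.cpc`, `STA.cpℓ`, `STA.cpwt`, `STA.cpe` — the family of
  the premise: the other substituends unchanged, the substituend of `x` replaced by `|S|` renamed
  copies owned by the slots of `S`, at level `ℓ x - 1`;
* `Family.copies` — it is a family for the premise's context, and its cost and degree bound are
  dominated by those of the original family (`famCost_copies_le`, `famDeg_copies_le`).

## References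

* [GaboardiRonchiDellaRocca2007] GR07, Substitution Lemma, case `(m)`.
* [GaboardiMarionRonchidellarocca2008] GMR08, Lemma 5.5 (rank and weight).
-/

namespace Literature.Computability.ImplicitComplexity

namespace STA

open Finset

/-! ### Slots of the copies -/

/-- The slots of the `s`-th copy: `t ↦ L + ⟨s, t⟩`. [folklore] -/
def copyRen (L s : ℕ) (t : ℕ) : ℕ := L + Nat.pair s t

/-- Copies live above `L`. [folklore] -/
theorem le_copyRen (L s t : ℕ) : L ≤ copyRen L s t := Nat.le_add_right _ _

/-- Decoding a copy slot. [folklore] -/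
@[simp] theorem unpair_copyRen (L s t : ℕ) : Nat.unpair (copyRen L s t - L) = (s, t) := by
  simp [copyRen]

/-- Copy slots are injective in both indices. [folklore] -/
theorem copyRen_eq_iff {L s t s' t' : ℕ} : copyRen L s t = copyRen L s' t' ↔ s = s' ∧ t = t' := by
  simp [copyRen, Nat.pair_eq_pair]

/-- Each copy renaming is injective. [folklore] -/
theorem copyRen_injective (L s : ℕ) : Function.Injective (copyRen L s) := fun _ _ h =>
  (copyRen_eq_iff.1 h).2

/-- A slot above `L` is the copy slot it decodes to. [folklore] -/
theorem eq_copyRen_of_le {L m : ℕ} (h : L ≤ m) :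
    m = copyRen L (Nat.unpair (m - L)).1 (Nat.unpair (m - L)).2 := by
  rw [copyRen, Nat.pair_unpair]
  omega

/-! ### The family of copies -/

/-- Substituted slots of the premise: the other slots, and the contracted slots. [folklore] -/
def cpX (X S : Finset ℕ) (j : ℕ) : Finset ℕ := X.erase j ∪ S

/-- Substituends of the premise: renamed copies of `N j` on the contracted slots. [folklore] -/
def cpN (L : ℕ) (S : Finset ℕ) (j : ℕ) (N : ℕ → Term) : ℕ → Term := fun i =>
  if i ∈ S then (N j).rename (copyRen L i) else N i

/-- Level-`0` context of the premise's family: the parts not owned by `j`, and the copies of the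
part owned by `j`. [folklore] -/
def cpΔ (L : ℕ) (S : Finset ℕ) (j : ℕ) (Δ : Ctx) (c : ℕ → ℕ) : Ctx := fun m =>
  if m < L then (if c m = j then none else Δ m)
  else if (Nat.unpair (m - L)).1 ∈ S ∧ c (Nat.unpair (m - L)).2 = j then Δ (Nat.unpair (m - L)).2
  else none

/-- Owner map of the premise's family. [folklore] -/
def cpc (L : ℕ) (c : ℕ → ℕ) : ℕ → ℕ := fun m => if m < L then c m else (Nat.unpair (m - L)).1

/-- Levels of the premise's family: the copies sit one level lower. [folklore] -/
def cpℓ (S : Finset ℕ) (j : ℕ) (ℓ : ℕ → ℕ) : ℕ → ℕ := fun x => if x ∈ S then ℓ j - 1 else ℓ x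

/-- Weights of the premise's family. [folklore] -/
def cpwt (S : Finset ℕ) (j : ℕ) (wt : ℕ → ℕ) : ℕ → ℕ := fun x => if x ∈ S then wt j else wt x

/-- Degrees of the premise's family. [folklore] -/
def cpe (S : Finset ℕ) (j : ℕ) (e : ℕ → ℕ) : ℕ → ℕ := fun x => if x ∈ S then e j else e x

section copies

variable {r : ℕ} {Θ₀ : Ctx} {S : Finset ℕ} {j : ℕ} {σ : SoftTy} {X : Finset ℕ} {N : ℕ → Term}
  {Δ : Ctx} {c ℓ wt e : ℕ → ℕ} {K : ℕ}

/-- The hypotheses of the `(m)`-case with the substituends already moved to the block `[K, 2K)`.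
[folklore] -/
structure MpxData (r : ℕ) (Θ₀ : Ctx) (S : Finset ℕ) (j : ℕ) (σ : SoftTy) (X : Finset ℕ) (N : ℕ → Term)
    (Δ : Ctx) (c ℓ wt e : ℕ → ℕ) (K : ℕ) : Prop where
  /-- the contracted slots have type `σ` in the premise -/
  hS : ∀ s ∈ S, Θ₀ s = some σ
  /-- the fresh slot of the multiplexor -/
  hj : Θ₀ j = none
  /-- the family of the conclusion -/
  F : Family r (Θ₀.mpx S j σ) X N Δ c ℓ wt e
  /-- the contracted-into slot is substituted -/
  hjX : j ∈ X
  /-- everything of the main derivation is below `K` -/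
  hKΘ : ∀ i, Θ₀ i ≠ none → i < K
  /-- the fresh slot is below `K` -/
  hKj : j < K
  /-- the substituends live in `[K, 2K)` -/
  hΔlo : ∀ i, Δ i ≠ none → K ≤ i
  /-- the substituends live in `[K, 2K)` -/
  hΔhi : ∀ i, Δ i ≠ none → i < 2 * K

namespace MpxData

/-- The fresh slot is not contracted. [folklore] -/
theorem hjS (D : MpxData r Θ₀ S j σ X N Δ c ℓ wt e K) : j ∉ S := fun h => by
  simpa [D.hj] using D.hS j h

/-- Contracted slots are below `K`. [folklore] -/
theorem hSK (D : MpxData r Θ₀ S j σ X N Δ c ℓ wt e K) {s : ℕ} (hs : s ∈ S) : s < K :=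
  D.hKΘ s (by simp [D.hS s hs])

/-- Contracted slots are not substituted (they are absent from the conclusion). [folklore] -/
theorem hSX (D : MpxData r Θ₀ S j σ X N Δ c ℓ wt e K) {s : ℕ} (hs : s ∈ S) : s ∉ X := fun h =>
  D.F.declared h (Ctx.mpx_of_mem Θ₀ σ hs)

/-- Substituted slots are below `K`. [folklore] -/
theorem hXK (D : MpxData r Θ₀ S j σ X N Δ c ℓ wt e K) {x : ℕ} (hx : x ∈ X) : x < K := by
  by_cases hxj : x = j
  · exact hxj ▸ D.hKj
  · have h := D.F.declared hx
    rw [Ctx.mpx_of_ne Θ₀ σ (fun h' => D.hSX h' hx) hxj] at h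
    exact D.hKΘ x h

/-- The type of the contracted-into slot: `σ.bang = !^{ℓ j} Bⱼ`. [folklore] -/
theorem sigma_eq (D : MpxData r Θ₀ S j σ X N Δ c ℓ wt e K) :
    ∃ B, σ = ⟨ℓ j - 1, B⟩ ∧ 1 ≤ ℓ j ∧ WTyping r (wt j) (e j) (Δ.part c j) (N j) ⟨0, B⟩ := by
  obtain ⟨B, hB, hD⟩ := D.F.deriv j D.hjX
  rw [Ctx.mpx_self Θ₀ σ D.hjS] at hB
  obtain ⟨m, C⟩ := σ
  simp only [SoftTy.bang, Option.some.injEq, SoftTy.mk.injEq] at hB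
  obtain ⟨h1, rfl⟩ := hB
  exact ⟨C, by congr 1; omega, by omega, hD⟩

/-- On the other substituted slots the premise and the conclusion context agree. [folklore] -/
theorem Θ₀_eq (D : MpxData r Θ₀ S j σ X N Δ c ℓ wt e K) {x : ℕ} (hx : x ∈ X.erase j) :
    Θ₀ x = (Θ₀.mpx S j σ) x :=
  (Ctx.mpx_of_ne Θ₀ σ (fun h => D.hSX h (mem_of_mem_erase hx)) (ne_of_mem_erase hx)).symm

/-- Free variables of the substituend of `j` are exactly the slots owned by `j`. [folklore] -/
theorem mem_fv_j_iff (D : MpxData r Θ₀ S j σ X N Δ c ℓ wt e K) (t : ℕ) :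
    t ∈ (N j).fv ↔ Δ t ≠ none ∧ c t = j := by
  obtain ⟨B, _, _, hD⟩ := D.sigma_eq
  constructor
  · intro ht
    have := hD.ne_none_of_mem_fv ht
    simp only [Ctx.part_apply] at this
    by_cases h : c t = j
    · exact ⟨by simpa [h] using this, h⟩
    · simp [h] at this
  · rintro ⟨h1, h2⟩
    exact D.F.tight j D.hjX t (by simp [h2, h1])

/-- The part of the copies' context owned by a contracted slot is the transported part of `j`.
[folklore] -/
theorem part_copy (D : MpxData r Θ₀ S j σ X N Δ c ℓ wt e K) {s : ℕ} (hs : s ∈ S) :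
    (cpΔ (2 * K) S j Δ c).part (cpc (2 * K) c) s = (Δ.part c j).remap (copyRen (2 * K) s) := by
  symm
  refine Ctx.remap_eq_of (copyRen_injective _ _) _ _ (fun t => ?_) (fun m hm => ?_)
  · have h1 : ¬ copyRen (2 * K) s t < 2 * K := not_lt.2 (le_copyRen _ _ _)
    simp [cpΔ, cpc, h1, hs]
  · simp only [Ctx.part_apply, cpc, cpΔ]
    by_cases hmL : m < 2 * K
    · simp only [hmL, if_true]
      by_cases hcs : c m = s
      · have hΔm : Δ m = none := by
          by_contra hne
          exact D.hSX hs (hcs ▸ D.F.owned m hne)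
        simp [hcs, hΔm]
      · simp [hcs]
    · simp only [hmL, if_false]
      by_cases hcs : (Nat.unpair (m - 2 * K)).1 = s
      · exact absurd ((eq_copyRen_of_le (not_lt.1 hmL)).trans (by rw [hcs])) (hm _).symm
      · simp [hcs]

/-- The parts owned by the other substituted slots are unchanged. [folklore] -/
theorem part_other (D : MpxData r Θ₀ S j σ X N Δ c ℓ wt e K) {x : ℕ} (hx : x ∈ X.erase j) :
    (cpΔ (2 * K) S j Δ c).part (cpc (2 * K) c) x = Δ.part c x := by
  have hxS : x ∉ S := fun h => D.hSX h (mem_of_mem_erase hx)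
  have hxj : x ≠ j := ne_of_mem_erase hx
  funext m
  simp only [Ctx.part_apply, cpc, cpΔ]
  by_cases hmL : m < 2 * K
  · simp only [hmL, if_true]
    by_cases hcx : c m = x
    · simp [hcx, hxj]
    · simp [hcx]
  · simp only [hmL, if_false]
    have hΔm : Δ m = none := by
      by_contra hne
      exact hmL (D.hΔhi m hne)
    by_cases hcx : (Nat.unpair (m - 2 * K)).1 = x
    · simp [hcx, hxS, hΔm]
    · by_cases hcx' : c m = x <;> simp [hcx, hcx', hΔm]

/-- **The copies form a family for the premise.** [cite: GaboardiRonchiDellaRocca2007, Substitution Lemma (case (m))] -/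
theorem copies (D : MpxData r Θ₀ S j σ X N Δ c ℓ wt e K) :
    Family r Θ₀ (cpX X S j) (cpN (2 * K) S j N) (cpΔ (2 * K) S j Δ c) (cpc (2 * K) c)
      (cpℓ S j ℓ) (cpwt S j wt) (cpe S j e) where
  deriv x hx := by
    rcases mem_union.1 hx with hx | hx
    · have hxS : x ∉ S := fun h => D.hSX h (mem_of_mem_erase hx)
      obtain ⟨B, hB, hD⟩ := D.F.deriv x (mem_of_mem_erase hx)
      refine ⟨B, ?_, ?_⟩
      · rw [D.Θ₀_eq hx, hB]
        simp [cpℓ, hxS]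
      · simpa [cpN, cpwt, cpe, hxS, D.part_other hx] using hD
    · obtain ⟨B, hσ, _, hD⟩ := D.sigma_eq
      refine ⟨B, ?_, ?_⟩
      · rw [D.hS x hx, hσ]
        simp [cpℓ, hx]
      · have := hD.rename (copyRen_injective (2 * K) x)
        simpa [cpN, cpwt, cpe, hx, D.part_copy hx] using this
  tight x hx m hm := by
    rcases mem_union.1 hx with hx | hx
    · have hxS : x ∉ S := fun h => D.hSX h (mem_of_mem_erase hx)
      rw [D.part_other hx] at hm
      simpa [cpN, hxS] using D.F.tight x (mem_of_mem_erase hx) m hm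
    · rw [D.part_copy hx] at hm
      by_cases hm' : ∃ t, copyRen (2 * K) x t = m
      · obtain ⟨t, rfl⟩ := hm'
        rw [Ctx.remap_apply (copyRen_injective _ _)] at hm
        have := D.F.tight j D.hjX t hm
        simpa [cpN, hx] using Term.mem_fv_rename.2 ⟨t, this, rfl⟩
      · push Not at hm'
        exact absurd (Ctx.remap_of_forall_ne _ hm') hm
  disjoint m hm := by
    simp only [cpΔ] at hm
    by_cases hmL : m < 2 * K
    · simp only [hmL, if_true] at hm
      by_cases hc : c m = j
      · simp [hc] at hm
      · simp only [hc, if_false] at hm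
        by_contra hΘ
        exact not_lt.2 (D.hΔlo m hm) (D.hKΘ m hΘ)
    · by_contra hΘ
      have := D.hKΘ m hΘ
      omega
  owned m hm := by
    simp only [cpΔ] at hm
    simp only [cpc, cpX]
    by_cases hmL : m < 2 * K
    · simp only [hmL, if_true] at hm ⊢
      by_cases hc : c m = j
      · simp [hc] at hm
      · simp only [hc, if_false] at hm
        exact mem_union_left _ (mem_erase.2 ⟨hc, D.F.owned m hm⟩)
    · simp only [hmL, if_false] at hm ⊢
      by_cases h : (Nat.unpair (m - 2 * K)).1 ∈ S ∧ c (Nat.unpair (m - 2 * K)).2 = j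
      · exact mem_union_right _ h.1
      · simp [h] at hm

/-- The copies cost no more than the original family: `|S| · r^{ℓ j - 1} ≤ r^{ℓ j}`.
[cite: GaboardiMarionRonchidellarocca2008, Lemma 5.5] -/
theorem famCost_copies_le (D : MpxData r Θ₀ S j σ X N Δ c ℓ wt e K) (hcard : S.card ≤ r) :
    famCost r (cpX X S j) (cpℓ S j ℓ) (cpwt S j wt) ≤ famCost r X ℓ wt := by
  obtain ⟨_, _, hℓ, _⟩ := D.sigma_eq
  have hdisj : Disjoint (X.erase j) S := disjoint_left.2 fun x hx hs => D.hSX hs (mem_of_mem_erase hx)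
  rw [famCost, cpX, sum_union hdisj]
  have h1 : ∑ x ∈ X.erase j, r ^ cpℓ S j ℓ x * cpwt S j wt x = ∑ x ∈ X.erase j, r ^ ℓ x * wt x :=
    sum_congr rfl fun x hx => by
      have hxS : x ∉ S := fun h => D.hSX h (mem_of_mem_erase hx)
      simp [cpℓ, cpwt, hxS]
  have h2 : ∑ x ∈ S, r ^ cpℓ S j ℓ x * cpwt S j wt x = S.card * (r ^ (ℓ j - 1) * wt j) := by
    rw [sum_const_nat fun x hx => ?_]
    simp [cpℓ, cpwt, hx]
  rw [h1, h2, famCost, ← add_sum_erase X _ D.hjX]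
  have h3 : S.card * (r ^ (ℓ j - 1) * wt j) ≤ r ^ ℓ j * wt j := by
    calc S.card * (r ^ (ℓ j - 1) * wt j) ≤ r * (r ^ (ℓ j - 1) * wt j) := Nat.mul_le_mul_right _ hcard
      _ = r ^ ℓ j * wt j := by
        rw [← mul_assoc, ← pow_succ']
        congr 2
        omega
  omega

/-- The copies' degree bound is dominated by the original one. [folklore] -/
theorem famDeg_copies_le (D : MpxData r Θ₀ S j σ X N Δ c ℓ wt e K) :
    famDeg (cpX X S j) (cpℓ S j ℓ) (cpe S j e) ≤ famDeg X ℓ e := by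
  refine Finset.sup_le fun x hx => ?_
  rcases mem_union.1 hx with hx | hx
  · have hxS : x ∉ S := fun h => D.hSX h (mem_of_mem_erase hx)
    simpa [cpℓ, cpe, hxS] using le_famDeg (mem_of_mem_erase hx) ℓ e
  · have := le_famDeg D.hjX ℓ e
    simp only [cpℓ, cpe, hx, if_true]
    omega

end MpxData

end copies

end STA

end Literature.Computability.ImplicitComplexity
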